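import Mathlib
import HarnessLib
import Summits.Ventures.LatticeQCDFlow.Scaling.AcceptanceVolumeDecayPi
import Summits.Ventures.LatticeQCDFlow.Scaling.WeightedIntegralInequalities

/-!
# LatticeQCDFlow / Scaling — the acceptance under the Bhattacharyya MIDPOINT LAW:
# `acc(p, q) = BC²·E_{ρ⊗ρ} e^{−|log w(a) − log w(b)|/2}` and the Jensen floor `acc ≥ BC²·e^{−σ/√2}`

HONEST FRAMING: exact (Metropolis-corrected) sampling algorithms for lattice gauge theory;
figures of merit are autocorrelation/cost numbers at stated couplings and volumes; no
continuum-physics claim.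

Venture `LatticeQCDFlow` (cell pub-lqcd), topic `Scaling`; FANOUT row 3 (`s0-u1-a`, S0-B
implementation A, GEN-15).  NEW WORK of the cell (elementary measure theory), not a published
result; NO definition is introduced.  Row 3's `Scaling/AcceptanceVolumeDecayPi` (GEN-12, imported)
proved the Bhattacharyya CEILING `acc(p, q) = ∫∫ min(p(a)q(b), p(b)q(a)) ≤ (∫ √(p q))² = BC²` on any
measure space and `Scaling/AcceptanceBhattacharyyaRigidityIntegral` (GEN-13) its equality case; the
size of the gap was not typed.  SETTING: a reference measure `μ` on `X` (s-finite where Fubini is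
used), a target density `p ≥ 0` and a model density `q ≥ 0` (measurable, integrable; no
normalisation is needed in this file), the importance weight `w = p/q`, the Bhattacharyya affinity
`BC = ∫ √(p q) dμ`, and the MIDPOINT LAW `ρ = √(p q)/BC` (the normalised geometric mean of target
and model; written out as the kernel `√(p(a)q(a))`, never as a new object).

Tools: row 3's `Scaling/WeightedIntegralInequalities` (GEN-15, imported: the tangent-line Jensen
floor `integral_mul_exp_ge`, the weighted Cauchy–Schwarz `sq_integral_mul_abs_le`, the
pair-variance factorisation `integral_prod_mul_mul_sq_sub`) and `integrable_sqrt_mul`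
(`Scaling/AcceptanceVolumeDecayPi`).

* §1 `min_eq_sqrt_mul_exp_of_pos` — `min(u, v) = √(uv)·e^{−|log u − log v|/2}` for `u, v > 0`, and
  its density form **`min_mul_eq_sqrt_mul_exp`** —
  `min(p(a)q(b), p(b)q(a)) = √(p(a)q(a))·√(p(b)q(b))·e^{−|log w(a) − log w(b)|/2}` for ALL `a, b`
  (where a density vanishes both sides are `0`);
* §2 **`meanAccept_eq_integral_midpointKernel`** — THE MIDPOINT IDENTITY
  `acc(p, q) = ∫∫ √(p(a)q(a)) √(p(b)q(b)) e^{−|log w(a) − log w(b)|/2} dμ dμ`, i.e.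
  `acc = BC²·E_{ρ⊗ρ}[e^{−|log w(a) − log w(b)|/2}]`: the equilibrium acceptance of the exact
  (independence-Metropolis) flow sampler is the squared Bhattacharyya affinity times the Laplace
  functional of the LOG-WEIGHT GAP of two independent draws from the midpoint law (the ceiling
  `acc ≤ BC²` is the bound `e^{−|·|/2} ≤ 1`; equality iff the log weight is `ρ`-a.e. constant, i.e.
  the flow is hit-or-miss — GEN-13's rigidity, not re-proved here);
* **`sq_integral_sqrt_mul_exp_le_meanAccept`** — THE JENSEN FLOOR
  `BC²·exp(−E_{ρ⊗ρ}|log w(a) − log w(b)|/2) ≤ acc(p, q)` whenever the gap has a first moment;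
* **`sq_integral_sqrt_mul_exp_sqrt_le_meanAccept`** — the SECOND-MOMENT form: for ANY centring
  constant `c`, `BC²·exp(−√(γ_c/(2·BC))) ≤ acc(p, q)` with `γ_c = ∫ √(p q)(log w − c)² dμ`
  (`γ_c/BC = E_ρ(log w − c)² ≥ Var_ρ(log w) = σ²`, optimal at `c = E_ρ log w`: `acc ≥ BC² e^{−σ/√2}`);
  `integral_sqrt_mul_logWeight_sq_le`, **`sq_integral_sqrt_mul_exp_le_meanAccept_of_abs_le`** —
  if `|log w − c| ≤ R` wherever `p q > 0` then `γ_c ≤ BC·R²` and `BC²·e^{−R/√2} ≤ acc(p, q)`.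

Reading (value-free): the Bhattacharyya ceiling of the equilibrium acceptance is tight up to a
factor controlled by the spread of the log importance weight under the midpoint law — the companion
file `Scaling/AcceptanceVolumeRatePi` uses this to show that `BC²` is the EXACT exponential rate of
the acceptance of a factorised flow in the number of blocks.  NOT CLAIMED: any acceptance, affinity
or variance value of ours; nothing re-scored.
-/

namespace Summit.Ventures.LatticeQCDFlow.Theory2

open MeasureTheory Filter

/-! ## §1 The pointwise midpoint identity -/

/-- For `u, v > 0`: `min(u, v) = √(u v)·e^{−|log u − log v|/2}`. [folklore] -/
theorem min_eq_sqrt_mul_exp_of_pos {u v : ℝ} (hu : 0 < u) (hv : 0 < v) :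
    min u v = Real.sqrt (u * v) * Real.exp (-|Real.log u - Real.log v| / 2) := by
  wlog huv : u ≤ v generalizing u v
  · rw [min_comm, mul_comm u v, abs_sub_comm]
    exact this hv hu (le_of_not_ge huv)
  rw [min_eq_left huv]
  have hlog : Real.log u ≤ Real.log v := Real.log_le_log hu huv
  rw [abs_of_nonpos (by linarith), neg_neg,
    show (Real.log u - Real.log v) / 2 = Real.log u * (1 / 2) - Real.log v * (1 / 2) by ring,
    Real.exp_sub, ← Real.rpow_def_of_pos hu, ← Real.rpow_def_of_pos hv, ← Real.sqrt_eq_rpow,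
    ← Real.sqrt_eq_rpow, Real.sqrt_mul hu.le]
  have hsv : Real.sqrt v ≠ 0 := (Real.sqrt_pos.2 hv).ne'
  field_simp
  rw [Real.sq_sqrt hu.le]

variable {X : Type*}

/-- **The midpoint identity, pointwise.**  For densities `p, q ≥ 0` and ALL `a, b`:
`min(p(a)q(b), p(b)q(a)) = √(p(a)q(a))·√(p(b)q(b))·exp(−|log(p(a)/q(a)) − log(p(b)/q(b))|/2)`;
where one of the four values vanishes both sides are `0`. [ours] -/
theorem min_mul_eq_sqrt_mul_exp {p q : X → ℝ} (hp0 : ∀ a, 0 ≤ p a) (hq0 : ∀ a, 0 ≤ q a)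
    (a b : X) :
    min (p a * q b) (p b * q a)
      = Real.sqrt (p a * q a) * Real.sqrt (p b * q b)
          * Real.exp (-|Real.log (p a / q a) - Real.log (p b / q b)| / 2) := by
  rcases (hp0 a).eq_or_lt with hpa | hpa
  · rw [← hpa, zero_mul, zero_mul, Real.sqrt_zero, zero_mul, zero_mul]
    exact min_eq_left (mul_nonneg (hp0 b) (hq0 a))
  rcases (hq0 a).eq_or_lt with hqa | hqa
  · rw [← hqa, mul_zero, mul_zero, Real.sqrt_zero, zero_mul, zero_mul]
    exact min_eq_right (mul_nonneg (hp0 a) (hq0 b))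
  rcases (hp0 b).eq_or_lt with hpb | hpb
  · rw [← hpb, zero_mul, zero_mul, Real.sqrt_zero, mul_zero, zero_mul]
    exact min_eq_right (mul_nonneg (hp0 a) (hq0 b))
  rcases (hq0 b).eq_or_lt with hqb | hqb
  · rw [← hqb, mul_zero, mul_zero, Real.sqrt_zero, mul_zero, zero_mul]
    exact min_eq_left (mul_nonneg (hp0 b) (hq0 a))
  rw [min_eq_sqrt_mul_exp_of_pos (mul_pos hpa hqb) (mul_pos hpb hqa), Real.log_mul hpa.ne' hqb.ne',
    Real.log_mul hpb.ne' hqa.ne', Real.log_div hpa.ne' hqa.ne', Real.log_div hpb.ne' hqb.ne',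
    ← Real.sqrt_mul (mul_nonneg hpa.le hqa.le)]
  congr 2
  · ring
  · congr 3
    ring

/-! ## §2 The acceptance under the midpoint law -/

variable [MeasurableSpace X] {μ : Measure X}

/-- **THE MIDPOINT IDENTITY.**  For densities `p, q ≥ 0` on any measure space:
`∫∫ min(p(a)q(b), p(b)q(a)) dμ dμ = ∫∫ √(p(a)q(a)) √(p(b)q(b)) e^{−|log(p(a)/q(a)) − log(p(b)/q(b))|/2} dμ dμ`,
i.e. `acc(p, q) = BC²·E_{ρ⊗ρ}[e^{−|log w(a) − log w(b)|/2}]` with `ρ = √(pq)/BC` the midpoint law and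
`w = p/q`. [ours] -/
theorem meanAccept_eq_integral_midpointKernel {p q : X → ℝ} (hp0 : ∀ a, 0 ≤ p a)
    (hq0 : ∀ a, 0 ≤ q a) :
    ∫ a, ∫ b, min (p a * q b) (p b * q a) ∂μ ∂μ
      = ∫ a, ∫ b, Real.sqrt (p a * q a) * Real.sqrt (p b * q b)
          * Real.exp (-|Real.log (p a / q a) - Real.log (p b / q b)| / 2) ∂μ ∂μ := by
  simp_rw [min_mul_eq_sqrt_mul_exp hp0 hq0]

/-- Measurability of the log weight `log(p/q)`. [folklore] -/
theorem measurable_logRatio {p q : X → ℝ} (hpm : Measurable p) (hqm : Measurable q) :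
    Measurable fun a => Real.log (p a / q a) :=
  (hpm.div hqm).log

/-- **A bounded log weight has every midpoint-law moment.**  If `|log(p/q) − c| ≤ R` wherever
`p q > 0` then `√(pq)(log(p/q) − c)² ∈ L¹(μ)` and `∫ √(pq)(log(p/q) − c)² dμ ≤ (∫√(pq) dμ)·R²`.
[ours] -/
theorem integral_sqrt_mul_logWeight_sq_le {p q : X → ℝ} (hp0 : ∀ a, 0 ≤ p a) (hpm : Measurable p)
    (hpi : Integrable p μ) (hq0 : ∀ a, 0 ≤ q a) (hqm : Measurable q) (hqi : Integrable q μ)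
    {c R : ℝ} (hbd : ∀ a, 0 < p a → 0 < q a → |Real.log (p a / q a) - c| ≤ R) :
    Integrable (fun a => Real.sqrt (p a * q a) * (Real.log (p a / q a) - c) ^ 2) μ ∧
    ∫ a, Real.sqrt (p a * q a) * (Real.log (p a / q a) - c) ^ 2 ∂μ
      ≤ (∫ a, Real.sqrt (p a * q a) ∂μ) * R ^ 2 := by
  have hk0 : ∀ a, 0 ≤ Real.sqrt (p a * q a) := fun a => Real.sqrt_nonneg _
  have hki : Integrable (fun a => Real.sqrt (p a * q a)) μ :=
    integrable_sqrt_mul hp0 hpm hpi hq0 hqm hqi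
  have hℓ := measurable_logRatio hpm hqm
  -- pointwise `√(pq)(ℓ − c)² ≤ √(pq) R²` (where `p q = 0` the kernel vanishes)
  have hpt : ∀ a, Real.sqrt (p a * q a) * (Real.log (p a / q a) - c) ^ 2
      ≤ Real.sqrt (p a * q a) * R ^ 2 := by
    intro a
    rcases (hp0 a).eq_or_lt with hpa | hpa
    · rw [← hpa, zero_mul, Real.sqrt_zero, zero_mul, zero_mul]
    rcases (hq0 a).eq_or_lt with hqa | hqa
    · rw [← hqa, mul_zero, Real.sqrt_zero, zero_mul, zero_mul]
    refine mul_le_mul_of_nonneg_left ?_ (hk0 a)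
    rw [← sq_abs]
    exact pow_le_pow_left₀ (abs_nonneg _) (hbd a hpa hqa) 2
  have h2 : Integrable (fun a => Real.sqrt (p a * q a) * (Real.log (p a / q a) - c) ^ 2) μ := by
    refine (hki.mul_const (R ^ 2)).mono' (hki.aestronglyMeasurable.mul
      ((hℓ.sub_const c).pow_const 2).aestronglyMeasurable) (Eventually.of_forall fun a => ?_)
    rw [Real.norm_of_nonneg (mul_nonneg (hk0 a) (sq_nonneg _))]
    exact hpt a
  refine ⟨h2, ?_⟩
  calc ∫ a, Real.sqrt (p a * q a) * (Real.log (p a / q a) - c) ^ 2 ∂μ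
      ≤ ∫ a, Real.sqrt (p a * q a) * R ^ 2 ∂μ := integral_mono h2 (hki.mul_const _) hpt
    _ = (∫ a, Real.sqrt (p a * q a) ∂μ) * R ^ 2 := integral_mul_const _ _

variable [SFinite μ]

/-- The midpoint kernel times the Laplace factor is integrable on `μ ⊗ μ` and its product integral
is the acceptance. [ours] -/
theorem integral_midpointKernel_prod {p q : X → ℝ} (hp0 : ∀ a, 0 ≤ p a) (hpm : Measurable p)
    (hpi : Integrable p μ) (hq0 : ∀ a, 0 ≤ q a) (hqm : Measurable q) (hqi : Integrable q μ) :
    Integrable (fun z : X × X => Real.sqrt (p z.1 * q z.1) * Real.sqrt (p z.2 * q z.2)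
        * Real.exp (-|Real.log (p z.1 / q z.1) - Real.log (p z.2 / q z.2)| / 2)) (μ.prod μ) ∧
    ∫ z, Real.sqrt (p z.1 * q z.1) * Real.sqrt (p z.2 * q z.2)
        * Real.exp (-|Real.log (p z.1 / q z.1) - Real.log (p z.2 / q z.2)| / 2) ∂(μ.prod μ)
      = ∫ a, ∫ b, min (p a * q b) (p b * q a) ∂μ ∂μ := by
  have hki : Integrable (fun a => Real.sqrt (p a * q a)) μ :=
    integrable_sqrt_mul hp0 hpm hpi hq0 hqm hqi
  have hℓ := measurable_logRatio hpm hqm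
  have hFm : Measurable fun z : X × X =>
      -|Real.log (p z.1 / q z.1) - Real.log (p z.2 / q z.2)| / 2 :=
    ((hℓ.comp measurable_fst).sub (hℓ.comp measurable_snd)).abs.neg.div_const _
  have hint := integrable_mul_exp_of_nonpos (M := μ.prod μ)
    (K := fun z : X × X => Real.sqrt (p z.1 * q z.1) * Real.sqrt (p z.2 * q z.2))
    (fun z => mul_nonneg (Real.sqrt_nonneg _) (Real.sqrt_nonneg _)) (hki.mul_prod hki) hFm
    (fun z => by
      have := abs_nonneg (Real.log (p z.1 / q z.1) - Real.log (p z.2 / q z.2))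
      linarith)
  refine ⟨hint, ?_⟩
  rw [integral_prod _ hint, meanAccept_eq_integral_midpointKernel hp0 hq0]

/-- **THE JENSEN FLOOR (mean absolute log-weight gap).**  For densities `p, q ≥ 0` with
`BC = ∫√(pq) > 0`, if the log-weight gap has a first moment under the midpoint pair law then
`BC²·exp(−(∫∫ √(p(a)q(a))√(p(b)q(b))|log w(a) − log w(b)|)/(2·BC²)) ≤ acc(p, q)`, i.e.
`acc ≥ BC²·e^{−E_{ρ⊗ρ}|log w(a) − log w(b)|/2}`. [ours] -/
theorem sq_integral_sqrt_mul_exp_le_meanAccept {p q : X → ℝ} (hp0 : ∀ a, 0 ≤ p a)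
    (hpm : Measurable p) (hpi : Integrable p μ) (hq0 : ∀ a, 0 ≤ q a) (hqm : Measurable q)
    (hqi : Integrable q μ) (hB : 0 < ∫ a, Real.sqrt (p a * q a) ∂μ)
    (hgap : Integrable (fun z : X × X => Real.sqrt (p z.1 * q z.1) * Real.sqrt (p z.2 * q z.2)
        * |Real.log (p z.1 / q z.1) - Real.log (p z.2 / q z.2)|) (μ.prod μ)) :
    (∫ a, Real.sqrt (p a * q a) ∂μ) ^ 2
        * Real.exp (-(∫ z, Real.sqrt (p z.1 * q z.1) * Real.sqrt (p z.2 * q z.2)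
            * |Real.log (p z.1 / q z.1) - Real.log (p z.2 / q z.2)| ∂(μ.prod μ))
            / (2 * (∫ a, Real.sqrt (p a * q a) ∂μ) ^ 2))
      ≤ ∫ a, ∫ b, min (p a * q b) (p b * q a) ∂μ ∂μ := by
  have hki : Integrable (fun a => Real.sqrt (p a * q a)) μ :=
    integrable_sqrt_mul hp0 hpm hpi hq0 hqm hqi
  have hℓ := measurable_logRatio hpm hqm
  have hFm : Measurable fun z : X × X =>
      -|Real.log (p z.1 / q z.1) - Real.log (p z.2 / q z.2)| / 2 :=
    ((hℓ.comp measurable_fst).sub (hℓ.comp measurable_snd)).abs.neg.div_const _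
  have hZ : ∫ z, Real.sqrt (p z.1 * q z.1) * Real.sqrt (p z.2 * q z.2) ∂(μ.prod μ)
      = (∫ a, Real.sqrt (p a * q a) ∂μ) ^ 2 := by
    rw [integral_prod_mul (fun a => Real.sqrt (p a * q a)) (fun a => Real.sqrt (p a * q a)), sq]
  have hKF : Integrable (fun z : X × X => Real.sqrt (p z.1 * q z.1) * Real.sqrt (p z.2 * q z.2)
      * (-|Real.log (p z.1 / q z.1) - Real.log (p z.2 / q z.2)| / 2)) (μ.prod μ) := by
    have e : (fun z : X × X => Real.sqrt (p z.1 * q z.1) * Real.sqrt (p z.2 * q z.2)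
        * (-|Real.log (p z.1 / q z.1) - Real.log (p z.2 / q z.2)| / 2))
        = fun z => (-(1 / 2 : ℝ)) * (Real.sqrt (p z.1 * q z.1) * Real.sqrt (p z.2 * q z.2)
            * |Real.log (p z.1 / q z.1) - Real.log (p z.2 / q z.2)|) := by
      funext z; ring
    rw [e]
    exact hgap.const_mul _
  have hJ := integral_mul_exp_ge (M := μ.prod μ)
    (K := fun z : X × X => Real.sqrt (p z.1 * q z.1) * Real.sqrt (p z.2 * q z.2))
    (F := fun z : X × X => -|Real.log (p z.1 / q z.1) - Real.log (p z.2 / q z.2)| / 2)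
    (fun z => mul_nonneg (Real.sqrt_nonneg _) (Real.sqrt_nonneg _)) (hki.mul_prod hki)
    (by rw [hZ]; positivity) hFm
    (fun z => by
      have := abs_nonneg (Real.log (p z.1 / q z.1) - Real.log (p z.2 / q z.2))
      linarith) hKF
  have hKF' : ∫ z, Real.sqrt (p z.1 * q z.1) * Real.sqrt (p z.2 * q z.2)
      * (-|Real.log (p z.1 / q z.1) - Real.log (p z.2 / q z.2)| / 2) ∂(μ.prod μ)
      = (-(1 / 2 : ℝ)) * ∫ z, Real.sqrt (p z.1 * q z.1) * Real.sqrt (p z.2 * q z.2)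
          * |Real.log (p z.1 / q z.1) - Real.log (p z.2 / q z.2)| ∂(μ.prod μ) := by
    rw [← integral_const_mul]
    congr 1
    funext z
    ring
  rw [hZ, hKF', (integral_midpointKernel_prod hp0 hpm hpi hq0 hqm hqi).2] at hJ
  convert hJ using 3
  field_simp

/-- **THE JENSEN FLOOR, SECOND-MOMENT FORM.**  For densities `p, q ≥ 0` with `BC = ∫√(pq) > 0`
and ANY centring constant `c` with `γ_c = ∫ √(pq)(log(p/q) − c)² < ∞`:
`BC²·exp(−√(γ_c/(2·BC))) ≤ acc(p, q)`.  Since `γ_c/BC = E_ρ(log w − c)²` is the second moment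
of the centred log weight under the midpoint law (least at `c = E_ρ log w`, where it is the variance
`σ²`), this reads `acc ≥ BC²·e^{−σ/√2}`. [ours] -/
theorem sq_integral_sqrt_mul_exp_sqrt_le_meanAccept {p q : X → ℝ} (hp0 : ∀ a, 0 ≤ p a)
    (hpm : Measurable p) (hpi : Integrable p μ) (hq0 : ∀ a, 0 ≤ q a) (hqm : Measurable q)
    (hqi : Integrable q μ) (hB : 0 < ∫ a, Real.sqrt (p a * q a) ∂μ) (c : ℝ)
    (h2 : Integrable (fun a => Real.sqrt (p a * q a) * (Real.log (p a / q a) - c) ^ 2) μ) :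
    (∫ a, Real.sqrt (p a * q a) ∂μ) ^ 2
        * Real.exp (-Real.sqrt ((∫ a, Real.sqrt (p a * q a) * (Real.log (p a / q a) - c) ^ 2 ∂μ)
            / (2 * ∫ a, Real.sqrt (p a * q a) ∂μ)))
      ≤ ∫ a, ∫ b, min (p a * q b) (p b * q a) ∂μ ∂μ := by
  set B := ∫ a, Real.sqrt (p a * q a) ∂μ with hBdef
  set γ := ∫ a, Real.sqrt (p a * q a) * (Real.log (p a / q a) - c) ^ 2 ∂μ with hγdef
  have hk0 : ∀ a, 0 ≤ Real.sqrt (p a * q a) := fun a => Real.sqrt_nonneg _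
  have hki : Integrable (fun a => Real.sqrt (p a * q a)) μ :=
    integrable_sqrt_mul hp0 hpm hpi hq0 hqm hqi
  have hℓ := measurable_logRatio hpm hqm
  have hgm : Measurable fun a => Real.log (p a / q a) - c := hℓ.sub_const c
  have hkg : Integrable (fun a => Real.sqrt (p a * q a) * (Real.log (p a / q a) - c)) μ :=
    integrable_mul_of_sq hk0 hki hgm h2
  -- the pair weight `K = k ⊗ k` and the gap `T(a, b) = (ℓ a − c) − (ℓ b − c) = ℓ a − ℓ b`
  have hK0 : ∀ z : X × X, 0 ≤ Real.sqrt (p z.1 * q z.1) * Real.sqrt (p z.2 * q z.2) :=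
    fun z => mul_nonneg (hk0 _) (hk0 _)
  have hKi : Integrable (fun z : X × X => Real.sqrt (p z.1 * q z.1) * Real.sqrt (p z.2 * q z.2))
      (μ.prod μ) := hki.mul_prod hki
  have hTm : Measurable fun z : X × X =>
      (Real.log (p z.1 / q z.1) - c) - (Real.log (p z.2 / q z.2) - c) :=
    (hgm.comp measurable_fst).sub (hgm.comp measurable_snd)
  have hV := integral_prod_mul_mul_sq_sub (M := μ) hki hkg h2
  have hKT2 : Integrable (fun z : X × X => Real.sqrt (p z.1 * q z.1) * Real.sqrt (p z.2 * q z.2)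
      * ((Real.log (p z.1 / q z.1) - c) - (Real.log (p z.2 / q z.2) - c)) ^ 2) (μ.prod μ) := by
    have e : (fun z : X × X => Real.sqrt (p z.1 * q z.1) * Real.sqrt (p z.2 * q z.2)
        * ((Real.log (p z.1 / q z.1) - c) - (Real.log (p z.2 / q z.2) - c)) ^ 2)
        = fun z => (Real.sqrt (p z.1 * q z.1) * (Real.log (p z.1 / q z.1) - c) ^ 2
            * Real.sqrt (p z.2 * q z.2)
            - 2 * (Real.sqrt (p z.1 * q z.1) * (Real.log (p z.1 / q z.1) - c)
              * (Real.sqrt (p z.2 * q z.2) * (Real.log (p z.2 / q z.2) - c))))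
            + Real.sqrt (p z.1 * q z.1) * (Real.sqrt (p z.2 * q z.2)
              * (Real.log (p z.2 / q z.2) - c) ^ 2) := by
      funext z; ring
    rw [e]
    exact ((h2.mul_prod hki).sub ((hkg.mul_prod hkg).const_mul _)).add (hki.mul_prod h2)
  have hCS := sq_integral_mul_abs_le hK0 hKi hTm hKT2
  have hgap := integrable_mul_abs_of_sq hK0 hKi hTm hKT2
  -- `∫∫ K T² = 2Bγ − 2α² ≤ 2Bγ`, so `(∫∫ K|T|)² ≤ B²·2Bγ = (2B²·√(γ/(2B)))²`
  have hZ : ∫ z, Real.sqrt (p z.1 * q z.1) * Real.sqrt (p z.2 * q z.2) ∂(μ.prod μ) = B ^ 2 := by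
    rw [integral_prod_mul (fun a => Real.sqrt (p a * q a)) (fun a => Real.sqrt (p a * q a)), sq]
  rw [hZ, hV] at hCS
  have hγ0 : 0 ≤ γ := integral_nonneg fun a => mul_nonneg (hk0 a) (sq_nonneg _)
  have hI0 : 0 ≤ ∫ z, Real.sqrt (p z.1 * q z.1) * Real.sqrt (p z.2 * q z.2)
      * |(Real.log (p z.1 / q z.1) - c) - (Real.log (p z.2 / q z.2) - c)| ∂(μ.prod μ) :=
    integral_nonneg fun z => mul_nonneg (hK0 z) (abs_nonneg _)
  have ht0 : 0 ≤ 2 * B ^ 2 * Real.sqrt (γ / (2 * B)) := by positivity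
  have hsq : (2 * B ^ 2 * Real.sqrt (γ / (2 * B))) ^ 2 = B ^ 2 * (2 * (B * γ)) := by
    rw [mul_pow, Real.sq_sqrt (by positivity)]
    field_simp
  have hle : ∫ z, Real.sqrt (p z.1 * q z.1) * Real.sqrt (p z.2 * q z.2)
      * |(Real.log (p z.1 / q z.1) - c) - (Real.log (p z.2 / q z.2) - c)| ∂(μ.prod μ)
      ≤ 2 * B ^ 2 * Real.sqrt (γ / (2 * B)) := by
    rw [← sq_le_sq₀ hI0 ht0, hsq]
    nlinarith [sq_nonneg (∫ a, Real.sqrt (p a * q a) * (Real.log (p a / q a) - c) ∂μ), hCS,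
      sq_nonneg B]
  -- the first-moment floor, then monotonicity of `exp`
  have hgap' : Integrable (fun z : X × X => Real.sqrt (p z.1 * q z.1) * Real.sqrt (p z.2 * q z.2)
      * |Real.log (p z.1 / q z.1) - Real.log (p z.2 / q z.2)|) (μ.prod μ) := by
    refine hgap.congr (Eventually.of_forall fun z => ?_)
    simp only
    congr 2
    ring
  have hfloor := sq_integral_sqrt_mul_exp_le_meanAccept hp0 hpm hpi hq0 hqm hqi hB hgap'
  refine le_trans ?_ hfloor
  refine mul_le_mul_of_nonneg_left (Real.exp_le_exp.2 ?_) (sq_nonneg _)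
  have hI : ∫ z, Real.sqrt (p z.1 * q z.1) * Real.sqrt (p z.2 * q z.2)
      * |Real.log (p z.1 / q z.1) - Real.log (p z.2 / q z.2)| ∂(μ.prod μ)
      ≤ 2 * B ^ 2 * Real.sqrt (γ / (2 * B)) := by
    refine le_of_eq_of_le (integral_congr_ae (Eventually.of_forall fun z => ?_)) hle
    simp only
    congr 2
    ring
  rw [neg_div, neg_le_neg_iff, div_le_iff₀ (by positivity)]
  linarith

/-- **THE JENSEN FLOOR FOR A BOUNDED LOG WEIGHT.**  If `|log(p/q) − c| ≤ R` wherever `p q > 0`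
(some constant `c`, radius `R ≥ 0`) then `BC²·e^{−R/√2} ≤ acc(p, q)`. [ours] -/
theorem sq_integral_sqrt_mul_exp_le_meanAccept_of_abs_le {p q : X → ℝ} (hp0 : ∀ a, 0 ≤ p a)
    (hpm : Measurable p) (hpi : Integrable p μ) (hq0 : ∀ a, 0 ≤ q a) (hqm : Measurable q)
    (hqi : Integrable q μ) (hB : 0 < ∫ a, Real.sqrt (p a * q a) ∂μ) {c R : ℝ} (hR : 0 ≤ R)
    (hbd : ∀ a, 0 < p a → 0 < q a → |Real.log (p a / q a) - c| ≤ R) :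
    (∫ a, Real.sqrt (p a * q a) ∂μ) ^ 2 * Real.exp (-(R / Real.sqrt 2))
      ≤ ∫ a, ∫ b, min (p a * q b) (p b * q a) ∂μ ∂μ := by
  set B := ∫ a, Real.sqrt (p a * q a) ∂μ with hBdef
  obtain ⟨h2, hγ⟩ := integral_sqrt_mul_logWeight_sq_le hp0 hpm hpi hq0 hqm hqi hbd
  have hfloor := sq_integral_sqrt_mul_exp_sqrt_le_meanAccept hp0 hpm hpi hq0 hqm hqi hB c h2
  refine le_trans (mul_le_mul_of_nonneg_left (Real.exp_le_exp.2 ?_) (sq_nonneg _)) hfloor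
  rw [neg_le_neg_iff]
  have hs : Real.sqrt ((∫ a, Real.sqrt (p a * q a) * (Real.log (p a / q a) - c) ^ 2 ∂μ) / (2 * B))
      ≤ Real.sqrt (R ^ 2 / 2) := by
    refine Real.sqrt_le_sqrt ?_
    rw [div_le_div_iff₀ (by positivity) (by norm_num)]
    nlinarith
  rw [Real.sqrt_div (sq_nonneg R), Real.sqrt_sq hR] at hs
  exact hs

end Summit.Ventures.LatticeQCDFlow.Theory2
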